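import Summits.SmoothPoincare4.SmoothPoincare4.Theses.SteinHost
import Literature.Topology.FourManifolds.ClosedBall
import Literature.Geometry.Symplectic.SteinBall
import Mathlib.Analysis.InnerProductSpace.Calculus
import Mathlib.Analysis.Normed.Module.Ball.Homeomorph

/-!
# Disproof of `SteinSchoenflies` — findings (refuter crux-attack, stmt-SmoothPoincare4-18228, 2026-08-17)

Verdict of the refuter-first cycle: **no kill; the crux survives**.  Kernel-checked content of
this file (0 `sorry`, axioms ⊆ {propext, Classical.choice, Quot.sound}):

* `steinSchoenflies_of_smoothPoincare4` — **S → C**: the summit implies the crux by a one-line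
  term (the crux's conclusion *is* SPC4's conclusion under extra binders).  Consequence: an
  unconditional `¬ SteinSchoenflies` would exhibit an exotic `S⁴`; the crux is SPC4-shielded and
  no refutation short of `¬ SPC4` exists.
* `Witness.hypotheses_satisfiable`, `Witness.crux_applies_to_witness` — **non-vacuity (A3)**: the
  hypotheses are jointly satisfiable by a genuine instance, `M = S⁴`, `p = -e₀`, `X = 𝔻⁴` with the
  tree's Stein structure `Literature.Geometry.Symplectic.isSteinDomain_closedBall`, and
  `f = univUnitBall ∘ (stereographic chart at e₀) : S⁴ ∖ {p} ↪ 𝔻⁴`, a smooth embedding in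
  Mathlib's chart sense `Manifold.IsSmoothEmbedding (𝓡 4) (𝓡∂ 4) ∞` (immersion witnessed by
  `IsImmersionAtOfComplement.mk_of_charts` with complement `PUnit`, domain chart `f + 2e₀`,
  codomain chart the interior chart `x ↦ x + 2e₀` of `𝔻⁴`).  So the crux is not true for lack
  of instances, and `Manifold.IsSmoothEmbedding (𝓡 4) (𝓡∂ 4)` (boundaryless source, bordered
  target) is inhabitable.

Paper findings (not formalised here; details in the item evidence `ATTACK.md`):

* **C → S does not collapse to the summit.**  `SteinSchoenflies → SmoothPoincare4` needs exactly
  the sibling crux `HostStein` (every punctured homotopy 4-sphere embeds in a compact Stein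
  surface).  The classical hosts are useless: Wall's `Σ # k(S²×S²) ≅ k(S²×S²)` and
  `Σ # ℂℙ² ≅ ℂℙ²`-type hosts contain essential spheres of square `0` / `±1`, which no Stein
  surface contains (Lisca–Matić adjunction: essential spheres have square `≤ -2`); so HostStein
  is genuinely open and the crux is not the summit in costume.
* **Load-bearing hypothesis = `IsSteinDomain X`.**  Dropping it (keeping `CompactSpace X`) makes
  the statement *equivalent* to SPC4: take `X := M ∖ (open chart ball at p)`, a compact bordered
  4-manifold into whose interior `M ∖ {p}` embeds by a radial push.  Any proof must use the Stein
  structure beyond compactness/orientability.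
* **Instance `X = 𝔻⁴` ≡ smooth 4-dimensional Schoenflies** (ball form: every homotopy 4-ball in
  `S⁴` is standard), via Palais–Cerf disc theorem and `Γ₄ = 0`.  Hence
  `SPC4 ⇒ SteinSchoenflies ⇒ Schoenflies`; the crux is Lambert-Cole, *Stein trisections and
  homotopy 4-balls*, arXiv:2104.02003, Conjecture 1.10 (p. 4, verbatim: "Let X be a compact Stein
  domain of complex dimension 2 and let B ⊂ X be an embedded homotopy 4-ball bounded by a smoothly
  embedded S³. Then B is a standard 4-ball."), transported to the punctured-sphere form the glue
  consumes (`M ∖ {p}` ↔ `M ∖ ball`, collar push into `Int X`).  Literature status 2026-08-17: open;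
  no counterexample or proof found (local citation graph: 2 citing works, arXiv:2212.13576,
  arXiv:2107.10929, neither addresses Conj. 1.10; Question 1.3 — hulls / envelope of holomorphy of
  the reimbedded `Z` — open even in `ℂ²`).
* **Interface `IsSteinDomain` is genuine, not junk-inhabitable**: `SteinStructure.convex` demands
  `0 < -(mextDeriv (d^ℂ φ)) x ![v, J v]`, and `Kaehler.mextDeriv` of a non-differentiable form is the
  junk value `0`, violating it; `boundary_eq` (boundary = level set of `max φ`) excludes closed `X`
  (φ attains its max on a compact nonempty `X`, which is nonempty because `M ∖ {p} ≠ ∅` maps in).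
* **Automatic interiority**: an `(𝓡 4) → (𝓡∂ 4)` immersion in Mathlib's chart sense lands in
  `Int X` (the linear normal form maps an open set of `ℝ⁴` onto an open set inside the closed
  half-space, hence inside the open half-space) — provers of `stub_ballInHost` get `f(U) ⊆ Int X`
  for free.
* Mutations: `p` arbitrary is harmless (homogeneity); quantifier order `∀ M he p X hX f hf` matches
  Conj. 1.10 ∘ (Palais + Cerf); dropping `M ≃ₕ S⁴` turns the statement into "compact Stein surfaces
  have no closed connected summand other than `S⁴`" (a summand must be negative definite with
  `b₁ = b₃ = 0` and no `(-1)`-spheres by Taubes/adjunction — informational only).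
-/

open scoped Manifold ContDiff Topology ContinuousMap
open Set Function Metric ContinuousMap
open Literature.Topology.FourManifolds Literature.Geometry.Symplectic

noncomputable section

set_option linter.dupNamespace false

namespace Summit.SmoothPoincare4.SmoothPoincare4.Cruxes.SteinSchoenflies.Disproof

open Summit.SmoothPoincare4.SmoothPoincare4.Theses.SteinHost (SteinSchoenflies)

/-- **S → C.** The summit implies the crux: under the crux's binders the conclusion is SPC4's
conclusion for `M`.  Hence any refutation of the crux is a disproof of SPC4 (an exotic `S⁴`). -/
theorem steinSchoenflies_of_smoothPoincare4 (h : _root_.SmoothPoincare4) : SteinSchoenflies := by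
  intro M _ _ _ _ _ he _p _X _ _ _ _ _ _ _hX _f _hf
  unfold _root_.SmoothPoincare4 Literature.SPC4.SmoothPoincareConjectureFour
    ContinuousMap.HomotopyEquiv.NonemptyDiffeomorphSphere at h
  exact h M ‹_› ‹_› he

/-! ## Non-vacuity witness: `M = S⁴`, `X = 𝔻⁴`, `f = univUnitBall ∘ stereographic` -/

namespace Witness


local notation "E4" => EuclideanSpace ℝ (Fin 4)
local notation "E5" => EuclideanSpace ℝ (Fin 5)
local notation "𝕊⁴" => (Metric.sphere (0 : EuclideanSpace ℝ (Fin 5)) 1)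
local notation "𝔻⁴" => (Metric.closedBall (0 : EuclideanSpace ℝ (Fin 4)) 1)

attribute [local instance] Literature.Topology.FourManifolds.fact_finrank_euclideanSpace_succ

/-- The base point `e₀ ∈ S⁴`. -/
def q₀ : 𝕊⁴ := ⟨EuclideanSpace.single 0 1, by simp⟩

/-- The puncture point `p = -e₀`. -/
def pt : 𝕊⁴ := -q₀

/-- The chart of `S⁴` at `e₀` is the stereographic projection from `p = -e₀`. -/
theorem chartAt_q₀ : chartAt E4 q₀ = stereographic' 4 (-q₀) := rfl

theorem chartAt_q₀_source : (chartAt E4 q₀).source = {pt}ᶜ := by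
  rw [chartAt_q₀, stereographic'_source]; rfl

theorem chartAt_q₀_target : (chartAt E4 q₀).target = univ := by
  rw [chartAt_q₀, stereographic'_target]

/-- The punctured sphere `S⁴ ∖ {p}` as an open submanifold. -/
def U : TopologicalSpace.Opens 𝕊⁴ := ⟨{pt}ᶜ, isOpen_compl_singleton⟩

theorem mem_source_of_U (y : U) : (y : 𝕊⁴) ∈ (chartAt E4 q₀).source := by
  rw [chartAt_q₀_source]; exact y.2

/-- The translation vector `2e₀` of the interior chart of `𝔻⁴`. -/
def c : E4 := (2 : ℝ) • closedBallBaseVector 3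

/-- The coordinate map `y ↦ univUnitBall (σ y)` into the open unit ball. -/
def g (y : U) : E4 := OpenPartialHomeomorph.univUnitBall (chartAt E4 q₀ (y : 𝕊⁴))

theorem norm_g_lt (y : U) : ‖g y‖ < 1 :=
  mem_ball_zero_iff.1 (OpenPartialHomeomorph.univUnitBall.map_source (mem_univ _))

/-- The embedding `f : S⁴ ∖ {p} → 𝔻⁴`. -/
def f (y : U) : 𝔻⁴ := ⟨g y, mem_closedBall_zero_iff.2 (norm_g_lt y).le⟩

theorem norm_f_lt (y : U) : ‖((f y : 𝔻⁴) : E4)‖ < 1 := norm_g_lt y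

/-- The inverse coordinate map. -/
def gInv (u : E4) : 𝕊⁴ :=
  (chartAt E4 q₀).symm (OpenPartialHomeomorph.univUnitBall.symm (u - c))

theorem gInv_mem (u : E4) : gInv u ∈ ({pt}ᶜ : Set 𝕊⁴) := by
  rw [← chartAt_q₀_source]
  exact (chartAt E4 q₀).map_target (by rw [chartAt_q₀_target]; trivial)

theorem continuous_g : Continuous g := by
  refine (OpenPartialHomeomorph.contDiff_univUnitBall (n := 0)).continuous.comp ?_
  exact (chartAt E4 q₀).continuousOn.comp_continuous continuous_subtype_val mem_source_of_U

theorem continuousOn_gInv : ContinuousOn gInv (ball c 1) := by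
  refine (chartAt E4 q₀).continuousOn_symm.comp
    (OpenPartialHomeomorph.univUnitBall.continuousOn_symm.comp
      (continuous_id.sub continuous_const).continuousOn ?_) ?_
  · intro u hu
    rw [OpenPartialHomeomorph.univUnitBall_target, mem_ball_zero_iff]
    rwa [mem_ball, dist_eq_norm] at hu
  · intro u _
    rw [chartAt_q₀_target]; trivial

/-- The domain chart: `y ↦ f y + 2e₀`, an open partial homeomorphism `U ≃ ball (2e₀) 1`. -/
def φ : OpenPartialHomeomorph U E4 where
  toFun y := g y + c
  invFun u := ⟨gInv u, gInv_mem u⟩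
  source := univ
  target := ball c 1
  map_source' y _ := by
    rw [mem_ball, dist_eq_norm, add_sub_cancel_right]; exact norm_g_lt y
  map_target' _ _ := mem_univ _
  left_inv' y _ := by
    apply Subtype.ext
    show gInv (g y + c) = y
    simp only [gInv, g, add_sub_cancel_right]
    rw [OpenPartialHomeomorph.univUnitBall.left_inv (mem_univ _),
      (chartAt E4 q₀).left_inv (mem_source_of_U y)]
  right_inv' u hu := by
    have hu' : u - c ∈ (OpenPartialHomeomorph.univUnitBall (E := E4)).target := by
      rw [OpenPartialHomeomorph.univUnitBall_target, mem_ball_zero_iff]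
      rwa [mem_ball, dist_eq_norm] at hu
    show OpenPartialHomeomorph.univUnitBall (chartAt E4 q₀ (gInv u)) + c = u
    simp only [gInv]
    rw [(chartAt E4 q₀).right_inv (by rw [chartAt_q₀_target]; trivial),
      OpenPartialHomeomorph.univUnitBall.right_inv hu', sub_add_cancel]
  open_source := isOpen_univ
  open_target := isOpen_ball
  continuousOn_toFun := (continuous_g.add continuous_const).continuousOn
  continuousOn_invFun := by
    rw [Topology.IsInducing.subtypeVal.continuousOn_iff]
    exact continuousOn_gInv

theorem φ_apply (y : U) : φ y = g y + c := rfl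
theorem φ_source : φ.source = univ := rfl
theorem φ_target : φ.target = ball c 1 := rfl
theorem φ_symm_apply_coe (u : E4) : ((φ.symm u : U) : 𝕊⁴) = gInv u := rfl

/-- `g` is smooth. -/
theorem contMDiff_g : ContMDiff (𝓡 4) 𝓘(ℝ, E4) ∞ g := by
  have h1 : ContMDiff (𝓡 4) (𝓡 4) ∞ (fun y : U => chartAt E4 q₀ (y : 𝕊⁴)) :=
    contMDiffOn_chart.comp_contMDiff contMDiff_subtype_val mem_source_of_U
  exact OpenPartialHomeomorph.contDiff_univUnitBall.comp_contMDiff h1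

/-- `gInv` is smooth on the ball. -/
theorem contMDiffOn_gInv : ContMDiffOn 𝓘(ℝ, E4) (𝓡 4) ∞ gInv (ball c 1) := by
  have ha : ContMDiffOn 𝓘(ℝ, E4) 𝓘(ℝ, E4) ∞ (fun u : E4 => u - c) (ball c 1) :=
    (contMDiff_id.sub contMDiff_const).contMDiffOn
  have hb : ContMDiffOn 𝓘(ℝ, E4) 𝓘(ℝ, E4) ∞
      (OpenPartialHomeomorph.univUnitBall (E := E4)).symm (ball 0 1) :=
    OpenPartialHomeomorph.contDiffOn_univUnitBall_symm.contMDiffOn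
  have hc : ContMDiffOn (𝓡 4) (𝓡 4) ∞ (chartAt E4 q₀).symm (chartAt E4 q₀).target :=
    contMDiffOn_chart_symm
  refine hc.comp (hb.comp ha ?_) ?_
  · intro u hu
    simp only [mem_preimage, mem_ball, dist_eq_norm, sub_zero] at hu ⊢
    exact hu
  · intro u _
    rw [chartAt_q₀_target]; trivial

/-- The domain chart belongs to the maximal `C^∞` atlas of `U`. -/
theorem φ_mem_maximalAtlas : φ ∈ IsManifold.maximalAtlas (𝓡 4) ∞ U := by
  refine φ.mem_maximalAtlas_of_contMDiffOn ?_ ?_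
  · rw [φ_source]
    exact (contMDiff_g.add contMDiff_const).contMDiffOn
  · rw [φ_target]
    intro u hu
    exact (ContMDiffWithinAt.subtypeVal_comp_iff U φ.symm (ball c 1) u).1 (contMDiffOn_gInv u hu)

/-- The trivial complement: `ℝ⁴ × 0 ≃ ℝ⁴`. -/
def equiv : (E4 × PUnit.{1}) ≃L[ℝ] E4 := ContinuousLinearEquiv.prodUnique ℝ E4 PUnit

/-- `f` is an immersion at every point (chartwise linear normal form). -/
theorem isImmersionAtOfComplement_f (x : U) :
    Manifold.IsImmersionAtOfComplement PUnit.{1} (𝓡 4) (𝓡∂ 4) ∞ f x := by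
  refine Manifold.IsImmersionAtOfComplement.mk_of_charts equiv φ
    (chartAt (EuclideanHalfSpace 4) (f x)) (mem_univ _) (mem_chart_source _ _)
    φ_mem_maximalAtlas (IsManifold.chart_mem_maximalAtlas _) ?_ ?_
  · intro y _
    show f y ∈ (chartAt (EuclideanHalfSpace 4) (f x)).source
    rw [closedBall_chartAt_of_norm_lt_one (norm_f_lt x), closedBallInteriorChart_source]
    exact norm_f_lt y
  · intro u hu
    have hu' : u ∈ ball c 1 := by
      simpa [OpenPartialHomeomorph.extend_target, φ_target] using hu
    simp only [Function.comp_apply]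
    rw [OpenPartialHomeomorph.extend_coe, OpenPartialHomeomorph.extend_coe_symm,
      closedBall_chartAt_of_norm_lt_one (norm_f_lt x)]
    simp only [Function.comp_apply, modelWithCornersSelf_coe_symm,
      modelWithCornersEuclideanHalfSpace_apply, coe_closedBallInteriorChart_apply]
    show g (φ.symm u) + (2 : ℝ) • closedBallBaseVector 3 = (u, (0 : PUnit)).1
    exact φ.right_inv hu'

/-- `f` is a `C^∞` immersion. -/
theorem isImmersion_f : Manifold.IsImmersion (𝓡 4) (𝓡∂ 4) ∞ f :=
  ⟨PUnit.{1}, inferInstance, inferInstance, isImmersionAtOfComplement_f⟩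

/-- `f` is a topological embedding. -/
theorem isEmbedding_f : Topology.IsEmbedding f := by
  rw [← Topology.IsEmbedding.subtypeVal.of_comp_iff]
  have hφ : Topology.IsOpenEmbedding φ := φ.to_isOpenEmbedding rfl
  have h : (Subtype.val ∘ f : U → E4) = (Homeomorph.addRight (-c)) ∘ φ := by
    funext y
    simp [f, φ_apply, Homeomorph.addRight]
  rw [h]
  exact (Homeomorph.isEmbedding _).comp hφ.isEmbedding

/-- `f : S⁴ ∖ {p} ↪ 𝔻⁴` is a smooth embedding in Mathlib's chart sense. -/
theorem isSmoothEmbedding_f : Manifold.IsSmoothEmbedding (𝓡 4) (𝓡∂ 4) ∞ f :=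
  ⟨isImmersion_f, isEmbedding_f⟩

/-- **Non-vacuity of the crux.** The hypotheses of `SteinSchoenflies` — binders copied verbatim —
are jointly satisfiable: `M = S⁴`, `he = refl`, `p = -e₀`, `X = 𝔻⁴` (compact Stein domain,
`isSteinDomain_closedBall`), `f` the above smooth embedding. -/
theorem hypotheses_satisfiable :
    ∃ (M : Type) (_ : TopologicalSpace M) (_ : T2Space M) (_ : SecondCountableTopology M)
      (_ : ChartedSpace (EuclideanSpace ℝ (Fin 4)) M) (_ : IsManifold (𝓡 4) ∞ M)
      (_ : M ≃ₕ Metric.sphere (0 : EuclideanSpace ℝ (Fin 5)) 1) (p : M)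
      (X : Type) (_ : TopologicalSpace X) (_ : T2Space X) (_ : SecondCountableTopology X)
      (_ : ChartedSpace (EuclideanHalfSpace 4) X) (_ : IsManifold (𝓡∂ 4) ∞ X) (_ : CompactSpace X)
      (_ : Literature.Geometry.Symplectic.IsSteinDomain X)
      (f : (⟨{p}ᶜ, isOpen_compl_singleton⟩ : TopologicalSpace.Opens M) → X),
      Manifold.IsSmoothEmbedding (𝓡 4) (𝓡∂ 4) ∞ f :=
  ⟨𝕊⁴, inferInstance, inferInstance, inferInstance, inferInstance, inferInstance,
    ContinuousMap.HomotopyEquiv.refl _, pt, 𝔻⁴, inferInstance, inferInstance, inferInstance,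
    inferInstance, inferInstance, inferInstance, isSteinDomain_closedBall, f, isSmoothEmbedding_f⟩

/-- The crux instantiated at the witness holds (its conclusion there is `S⁴ ≅ S⁴`): the witness
is consistent with the crux, as it must be for a non-junk instance. -/
theorem crux_at_witness :
    Nonempty (𝕊⁴ ≃ₘ⟮𝓡 4, 𝓡 4⟯ Metric.sphere (0 : EuclideanSpace ℝ (Fin 5)) 1) :=
  ⟨Diffeomorph.refl _ _ _⟩

/-- **Tie to the crux, literally.** Applying the route decl `SteinSchoenflies` to the witness
type-checks, i.e. the witness instantiates exactly the crux's binders (no re-quantification). -/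
theorem crux_applies_to_witness
    (h : SteinSchoenflies) :
    Nonempty (𝕊⁴ ≃ₘ⟮𝓡 4, 𝓡 4⟯ Metric.sphere (0 : EuclideanSpace ℝ (Fin 5)) 1) :=
  h 𝕊⁴ (ContinuousMap.HomotopyEquiv.refl _) pt 𝔻⁴ isSteinDomain_closedBall f isSmoothEmbedding_f


end Witness

end Summit.SmoothPoincare4.SmoothPoincare4.Cruxes.SteinSchoenflies.Disproof

end
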